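import Mathlib.Analysis.InnerProductSpace.PiL2
import Mathlib.Analysis.Normed.Module.Connected
import Literature.Geometry.Symplectic.StandardEnd

/-!
# The end does not return — topological dichotomy (helper for stub `stub_endDoesNotReturn`,
line `cross-cap-laurent`, crux `SymplecticOrigami.GromovRecognitionRelEnd` ≡
`SymplecticCap.GromovRecognitionRelEnd`, item stmt-SmoothPoincare4-11009; first of three files)

The stub says: under the end hypotheses of Gromov's recognition theorem relative at infinity
(McDuff–Salamon 2017, Rem. 4.5.2 (viii)) — `ψ|Kᶜ` a bijection onto `{R < ‖z‖} ⊆ ℝ⁴` with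
inverse `χ`, every sub-end `K ∪ {‖ψ‖ ≤ R'}` compact — every truncation
`K ∪ {x ∈ Kᶜ | ‖ψ x‖ < R'}`, `R' > R`, is OPEN, i.e. the `∞`-side of the end does not accumulate
on `K`.

This file is the purely TOPOLOGICAL half (no symplectic form), adapted from the refuter's
checked dichotomy (`Cruxes/GromovRecognitionRelEnd/Disproof.lean`, §2 and §13, which a
`Theorems/` file may not import):

* `isClosed_of_ends`, `isCompact_of_ends` — H5 at `R' = R` with `ψ(Kᶜ) ⊆ {R < ‖z‖}` force
  `K` closed, hence compact;
* `isConnected_compl_closedBall` — `{r < ‖z‖} ⊆ ℝ⁴` is connected (`r ≥ 0`);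
* `noAccumulation_or_compactSpace` — **dichotomy**: over H5, continuity of `ψ` on `Kᶜ` and
  of `χ` on `{R < ‖z‖}`, bijectivity and `χ ∘ ψ = id`, EITHER every truncation is open OR `M`
  is compact (frontier/connectedness argument: for an open `V ⊇ K` with compact closure the
  far region `{R₂ < ‖z‖}` is connected and misses `ψ(∂V)`, so `χ` maps it into `V` — then `M`
  is compact — or off `closure V` — then the truncation is a neighbourhood of each point of
  `K`).

The symplectic half (`M` is NOT compact: the `ψ*ω₀`-volume of the end is infinite while a
continuous `sf` has locally finite chart volume) is the second file, the stub itself the third.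
The model space is written `EuclideanSpace ℝ (Fin 4)` throughout (no local notation).

References: D. McDuff, D. Salamon, *Introduction to Symplectic Topology*, 3rd ed. (2017),
Rem. 4.5.2 (viii) [McDuffSalamon2017]; M. Gromov, Invent. Math. 82 (1985), §0.3.C
[Gromov1985].
-/

noncomputable section

-- the prescribed namespace `Summit.<P>.<Sub>.…` duplicates `SmoothPoincare4` (P = Sub)
set_option linter.dupNamespace false

open scoped Manifold ContDiff Topology
open Set TopologicalSpace Literature.Geometry.Kaehler Literature.Geometry.Symplectic

namespace Summit.SmoothPoincare4.SmoothPoincare4.Theorems.GromovRecognitionRelEnd.CrossCapLaurent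

/-! ## Structure forced by the end hypotheses -/

section Structure

variable {M : Type} [TopologicalSpace M]

-- adapted from Cruxes/GromovRecognitionRelEnd/Disproof.lean (isClosed_of_endsCoCompact)
/-- H5 (at `R' = R`) and `ψ(Kᶜ) ⊆ {R < ‖z‖}` force `K` to be CLOSED: a point of
`closure K ∖ K` lies in `Kᶜ`, so `R < ‖ψ x‖`, so it is outside the compact (closed) set
`K ∪ {‖ψ‖ ≤ R} ⊇ K`. [folklore] -/
theorem isClosed_of_ends [T2Space M] {K : Set M} {R : ℝ} {ψ : M → EuclideanSpace ℝ (Fin 4)}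
    (h5 : ∀ R', R ≤ R' → IsCompact (K ∪ {x | ‖ψ x‖ ≤ R'}))
    (h8 : Set.MapsTo ψ Kᶜ (Metric.closedBall (0 : EuclideanSpace ℝ (Fin 4)) R)ᶜ) :
    IsClosed K := by
  have hC : IsClosed (K ∪ {x | ‖ψ x‖ ≤ R}) := (h5 R le_rfl).isClosed
  rw [← closure_subset_iff_isClosed]
  intro x hx
  have hxC : x ∈ K ∪ {x | ‖ψ x‖ ≤ R} := closure_minimal subset_union_left hC hx
  rcases hxC with hxK | hxR
  · exact hxK
  · by_contra hxK
    have h := h8 hxK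
    simp only [mem_compl_iff, Metric.mem_closedBall, dist_zero_right, not_le] at h
    exact absurd hxR (not_le.2 h)

-- adapted from Cruxes/GromovRecognitionRelEnd/Disproof.lean (isCompact_of_endsCoCompact)
/-- Hence `K` is COMPACT (closed subset of the compact `K ∪ {‖ψ‖ ≤ R}`). [folklore] -/
theorem isCompact_of_ends [T2Space M] {K : Set M} {R : ℝ} {ψ : M → EuclideanSpace ℝ (Fin 4)}
    (h5 : ∀ R', R ≤ R' → IsCompact (K ∪ {x | ‖ψ x‖ ≤ R'}))
    (h8 : Set.MapsTo ψ Kᶜ (Metric.closedBall (0 : EuclideanSpace ℝ (Fin 4)) R)ᶜ) :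
    IsCompact K :=
  (h5 R le_rfl).of_isClosed_subset (isClosed_of_ends h5 h8) subset_union_left

end Structure

/-! ## The dichotomy: no accumulation, or `M` compact -/

section Dichotomy

-- adapted from Cruxes/GromovRecognitionRelEnd/Disproof.lean (isConnected_compl_closedBall)
/-- The complement of a closed ball of radius `r ≥ 0` in `ℝ⁴` is connected (it is the image of
`S³ × (r, ∞)` under `(x, t) ↦ t • x`; `ℝ⁴` has dimension `4 > 1`). [folklore] -/
theorem isConnected_compl_closedBall {r : ℝ} (hr : 0 ≤ r) :
    IsConnected (Metric.closedBall (0 : EuclideanSpace ℝ (Fin 4)) r)ᶜ := by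
  have hrk : 1 < Module.rank ℝ (EuclideanSpace ℝ (Fin 4)) := by
    rw [← Module.finrank_eq_rank, finrank_euclideanSpace_fin]
    norm_num
  have hS : IsConnected (Metric.sphere (0 : EuclideanSpace ℝ (Fin 4)) 1 ×ˢ Ioi r) :=
    (isConnected_sphere hrk 0 zero_le_one).prod isConnected_Ioi
  have himg : (fun q : EuclideanSpace ℝ (Fin 4) × ℝ => q.2 • q.1) ''
      (Metric.sphere (0 : EuclideanSpace ℝ (Fin 4)) 1 ×ˢ Ioi r) =
      (Metric.closedBall (0 : EuclideanSpace ℝ (Fin 4)) r)ᶜ := by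
    ext z
    simp only [mem_image, mem_prod, mem_sphere_iff_norm, sub_zero, mem_Ioi, Prod.exists,
      mem_compl_iff, Metric.mem_closedBall, dist_zero_right, not_le]
    constructor
    · rintro ⟨x, t, ⟨hx, ht⟩, rfl⟩
      rw [norm_smul, hx, mul_one, Real.norm_eq_abs, abs_of_pos (hr.trans_lt ht)]
      exact ht
    · intro hz
      have hz0 : ‖z‖ ≠ 0 := by linarith
      refine ⟨‖z‖⁻¹ • z, ‖z‖, ⟨?_, hz⟩, ?_⟩
      · rw [norm_smul, norm_inv, norm_norm, inv_mul_cancel₀ hz0]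
      · rw [smul_smul, mul_inv_cancel₀ hz0, one_smul]
  rw [← himg]
  exact hS.image _ ((continuous_snd.smul continuous_fst).continuousOn)

variable {M : Type} [TopologicalSpace M] [T2Space M] [LocallyCompactSpace M]

-- adapted from Cruxes/GromovRecognitionRelEnd/Disproof.lean (noAccumulation_or_compactSpace)
/-- **Dichotomy: no accumulation, or `M` compact.** Topological end hypotheses only: every
sub-end `K ∪ {‖ψ‖ ≤ R'}` (`R' ≥ R`) compact, `ψ` continuous on `Kᶜ`, `χ` continuous on
`{R < ‖z‖}`, `ψ : Kᶜ → {R < ‖z‖}` bijective with left inverse `χ`. Then either every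
truncation `K ∪ {x ∈ Kᶜ | ‖ψ x‖ < R'}` (`R' > R`) is open, or `M` is compact.
Proof: if the truncation at `R'` is not open, it fails to be a neighbourhood of some `x₀ ∈ K`;
take an open `V ⊇ K` with compact closure; `ψ(closure V ∖ V)` is bounded by some `r₀`; on the
connected far region `A = {R₂ < ‖z‖}` (`R₂ > R', r₀`) the set `{z ∈ A | χ z ∈ V}` is clopen
(a limit point `z` with `χ z ∈ closure V ∖ V` would have `‖z‖ ≤ r₀`), so either `χ(A) ⊆ V` —
then `M = (K ∪ {‖ψ‖ ≤ R₂}) ∪ closure V` is compact — or `χ(A) ∩ V = ∅` — then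
`V ∖ χ({R' ≤ ‖z‖ ≤ R₂})` is an open neighbourhood of `x₀` inside the truncation,
contradiction. [folklore] -/
theorem noAccumulation_or_compactSpace (K : Set M) (R : ℝ) (ψ : M → EuclideanSpace ℝ (Fin 4))
    (χ : EuclideanSpace ℝ (Fin 4) → M)
    (h5 : ∀ R', R ≤ R' → IsCompact (K ∪ {x | ‖ψ x‖ ≤ R'})) (hψ : ContinuousOn ψ Kᶜ)
    (hχ : ContinuousOn χ (Metric.closedBall (0 : EuclideanSpace ℝ (Fin 4)) R)ᶜ)
    (h8 : Set.BijOn ψ Kᶜ (Metric.closedBall (0 : EuclideanSpace ℝ (Fin 4)) R)ᶜ)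
    (h9 : ∀ x, x ∈ Kᶜ → χ (ψ x) = x) :
    (∀ R', R < R' → IsOpen (K ∪ {x | x ∈ Kᶜ ∧ ‖ψ x‖ < R'})) ∨ CompactSpace M := by
  classical
  -- notation and basic facts
  set T : Set (EuclideanSpace ℝ (Fin 4)) :=
    (Metric.closedBall (0 : EuclideanSpace ℝ (Fin 4)) R)ᶜ with hT
  have hmemT : ∀ z, z ∈ T ↔ R < ‖z‖ := fun z => by
    simp [hT, Metric.mem_closedBall, dist_zero_right]
  have hKc : IsCompact K := isCompact_of_ends h5 h8.mapsTo
  have hKcl : IsClosed K := isClosed_of_ends h5 h8.mapsTo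
  have hright : ∀ z, z ∈ T → χ z ∈ Kᶜ ∧ ψ (χ z) = z := by
    intro z hz
    obtain ⟨x, hx, rfl⟩ := h8.surjOn hz
    rw [h9 x hx]
    exact ⟨hx, rfl⟩
  rw [or_iff_not_imp_left]
  intro hA
  simp only [not_forall] at hA
  obtain ⟨R', hR', hU⟩ := hA
  set U : Set M := K ∪ {x | x ∈ Kᶜ ∧ ‖ψ x‖ < R'} with hU_def
  -- the open part of `U`
  have hU' : IsOpen (Kᶜ ∩ ψ ⁻¹' Metric.ball (0 : EuclideanSpace ℝ (Fin 4)) R') :=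
    hψ.isOpen_inter_preimage hKcl.isOpen_compl Metric.isOpen_ball
  -- a point `x₀ ∈ K` at which `U` is not a neighbourhood
  obtain ⟨x₀, hx₀U, hx₀⟩ : ∃ x₀ ∈ U, U ∉ 𝓝 x₀ := by
    by_contra hcon
    simp only [not_exists, not_and, not_not] at hcon
    exact hU (isOpen_iff_mem_nhds.2 hcon)
  have hx₀K : x₀ ∈ K := by
    rcases hx₀U with h | ⟨hxK, hxR⟩
    · exact h
    · exfalso
      apply hx₀
      refine Filter.mem_of_superset
        (hU'.mem_nhds ⟨hxK, by simpa [Metric.mem_ball, dist_zero_right] using hxR⟩) ?_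
      rintro y ⟨hyK, hyR⟩
      exact Or.inr ⟨hyK, by simpa [Metric.mem_ball, dist_zero_right] using hyR⟩
  -- an open neighbourhood `V ⊇ K` with compact closure; `ψ(closure V ∖ V)` is bounded by `r₀`
  obtain ⟨V, hVo, hKV, hN⟩ := exists_isOpen_superset_and_isCompact_closure hKc
  have hB : IsCompact (closure V \ V) := hN.diff hVo
  have hBK : closure V \ V ⊆ Kᶜ := fun x hx hxK => hx.2 (hKV hxK)
  obtain ⟨r₀, hr₀⟩ := (hB.image_of_continuousOn (hψ.mono hBK)).isBounded.subset_closedBall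
    (0 : EuclideanSpace ℝ (Fin 4))
  -- the far region `A = {R₂ < ‖z‖}`
  set R₂ : ℝ := |R'| + |r₀| + 1 with hR₂
  have hR₂R' : R' ≤ R₂ := by rw [hR₂]; linarith [le_abs_self R', abs_nonneg r₀]
  have hR₂r₀ : r₀ < R₂ := by rw [hR₂]; linarith [le_abs_self r₀, abs_nonneg R']
  have hR₂0 : 0 ≤ R₂ := by rw [hR₂]; positivity
  have hR₂R : R < R₂ := hR'.trans_le hR₂R'
  set A : Set (EuclideanSpace ℝ (Fin 4)) :=
    (Metric.closedBall (0 : EuclideanSpace ℝ (Fin 4)) R₂)ᶜ with hA_def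
  have hmemA : ∀ z, z ∈ A ↔ R₂ < ‖z‖ := fun z => by
    simp [hA_def, Metric.mem_closedBall, dist_zero_right]
  have hAT : A ⊆ T := fun z hz => (hmemT z).2 (hR₂R.trans ((hmemA z).1 hz))
  have hAo : IsOpen A := Metric.isClosed_closedBall.isOpen_compl
  have hAconn : IsConnected A := isConnected_compl_closedBall hR₂0
  have hχA : ContinuousOn χ A := hχ.mono hAT
  -- for `z ∈ A`, `χ z ∉ closure V ∖ V`
  have hnotB : ∀ z, z ∈ A → χ z ∈ closure V → χ z ∈ V := by
    intro z hz hzc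
    by_contra hzV
    have hzB : χ z ∈ closure V \ V := ⟨hzc, hzV⟩
    have h1 : ψ (χ z) ∈ ψ '' (closure V \ V) := mem_image_of_mem ψ hzB
    have h2 := hr₀ h1
    rw [(hright z (hAT hz)).2, Metric.mem_closedBall, dist_zero_right] at h2
    linarith [(hmemA z).1 hz]
  -- the clopen decomposition of `A`
  have hPo : IsOpen (A ∩ χ ⁻¹' V) := hχA.isOpen_inter_preimage hAo hVo
  have hQo : IsOpen (A ∩ χ ⁻¹' (closure V)ᶜ) :=
    hχA.isOpen_inter_preimage hAo isClosed_closure.isOpen_compl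
  have hcover : A ⊆ (A ∩ χ ⁻¹' V) ∪ (A ∩ χ ⁻¹' (closure V)ᶜ) := by
    intro z hz
    by_cases h : χ z ∈ closure V
    · exact Or.inl ⟨hz, hnotB z hz h⟩
    · exact Or.inr ⟨hz, h⟩
  have hdisj : A ∩ ((A ∩ χ ⁻¹' V) ∩ (A ∩ χ ⁻¹' (closure V)ᶜ)) = ∅ := by
    ext z
    simp only [mem_inter_iff, mem_preimage, mem_compl_iff, mem_empty_iff_false, iff_false]
    rintro ⟨-, ⟨-, hzV⟩, -, hzc⟩
    exact hzc (subset_closure hzV)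
  rcases (isPreconnected_iff_subset_of_disjoint.1 hAconn.isPreconnected) _ _ hPo hQo hcover
    hdisj with hall | hnone
  · -- Case `χ(A) ⊆ V`: `M` is compact
    have huniv : (univ : Set M) ⊆ (K ∪ {x | ‖ψ x‖ ≤ R₂}) ∪ closure V := by
      intro x _
      by_cases hxK : x ∈ K
      · exact Or.inl (Or.inl hxK)
      · by_cases hxR : ‖ψ x‖ ≤ R₂
        · exact Or.inl (Or.inr hxR)
        · right
          have hzA : ψ x ∈ A := (hmemA _).2 (not_le.1 hxR)
          have h := (hall hzA).2
          rw [mem_preimage, h9 x hxK] at h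
          exact subset_closure h
    exact ⟨((h5 R₂ hR₂R.le).union hN).of_isClosed_subset isClosed_univ huniv⟩
  · -- Case `χ(A) ∩ closure V = ∅`: `U` is a neighbourhood of `x₀` after all
    exfalso
    apply hx₀
    -- the compact annulus part `D = χ({R' ≤ ‖z‖ ≤ R₂})`
    set Ann : Set (EuclideanSpace ℝ (Fin 4)) := {z | R' ≤ ‖z‖ ∧ ‖z‖ ≤ R₂} with hAnn
    have hAnnT : Ann ⊆ T := fun z hz => (hmemT z).2 (hR'.trans_le hz.1)
    have hAnnc : IsCompact Ann := by
      refine Metric.isCompact_of_isClosed_isBounded ?_ ?_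
      · exact (isClosed_le continuous_const continuous_norm).inter
          (isClosed_le continuous_norm continuous_const)
      · refine (Metric.isBounded_closedBall (x := (0 : EuclideanSpace ℝ (Fin 4)))
          (r := R₂)).subset fun z hz => ?_
        simpa [Metric.mem_closedBall, dist_zero_right] using hz.2
    have hD : IsCompact (χ '' Ann) := hAnnc.image_of_continuousOn (hχ.mono hAnnT)
    have hDK : χ '' Ann ⊆ Kᶜ := by
      rintro _ ⟨z, hz, rfl⟩
      exact (hright z (hAnnT hz)).1
    have hWo : IsOpen (V ∩ (χ '' Ann)ᶜ) := hVo.inter hD.isClosed.isOpen_compl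
    have hx₀W : x₀ ∈ V ∩ (χ '' Ann)ᶜ := ⟨hKV hx₀K, fun h => hDK h hx₀K⟩
    refine Filter.mem_of_superset (hWo.mem_nhds hx₀W) ?_
    rintro x ⟨hxV, hxD⟩
    by_cases hxK : x ∈ K
    · exact Or.inl hxK
    · refine Or.inr ⟨hxK, ?_⟩
      by_contra hlt
      rw [not_lt] at hlt
      by_cases hle : ‖ψ x‖ ≤ R₂
      · exact hxD ⟨ψ x, ⟨hlt, hle⟩, h9 x hxK⟩
      · have hzA : ψ x ∈ A := (hmemA _).2 (not_le.1 hle)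
        have h := (hnone hzA).2
        rw [mem_preimage, h9 x hxK] at h
        exact h (subset_closure hxV)

end Dichotomy

/-! ## Registered helper sub-goal -/

/-- **Registered helper sub-goal `helper_endDichotomy`** (the dichotomy
`noAccumulation_or_compactSpace` in closed form): over the topological end hypotheses, either
every truncation `K ∪ {x ∈ Kᶜ | ‖ψ x‖ < R'}` (`R' > R`) is open, or `M` is compact. [folklore] -/
theorem helper_endDichotomy : ∀ (M : Type) [TopologicalSpace M] [T2Space M]
    [LocallyCompactSpace M] (K : Set M) (R : ℝ) (ψ : M → EuclideanSpace ℝ (Fin 4))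
    (χ : EuclideanSpace ℝ (Fin 4) → M),
    (∀ R', R ≤ R' → IsCompact (K ∪ {x | ‖ψ x‖ ≤ R'})) → ContinuousOn ψ Kᶜ →
    ContinuousOn χ (Metric.closedBall (0 : EuclideanSpace ℝ (Fin 4)) R)ᶜ →
    Set.BijOn ψ Kᶜ (Metric.closedBall (0 : EuclideanSpace ℝ (Fin 4)) R)ᶜ →
    (∀ x, x ∈ Kᶜ → χ (ψ x) = x) →
    (∀ R', R < R' → IsOpen (K ∪ {x | x ∈ Kᶜ ∧ ‖ψ x‖ < R'})) ∨ CompactSpace M :=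
  fun _ _ _ _ K R ψ χ h5 hψ hχ h8 h9 => noAccumulation_or_compactSpace K R ψ χ h5 hψ hχ h8 h9

end Summit.SmoothPoincare4.SmoothPoincare4.Theorems.GromovRecognitionRelEnd.CrossCapLaurent

end
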